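import Mathlib
import Summits.ResolutionOfSingularities.ResolutionOfSingularities.Theorems.WeightedInvariantLocalWeightedDropMonicDescentTailPointStep

/-!
# `WeightedInvariant.LocalWeightedDrop`, sub-stub N4″: NO INFINITE Σ**-CHAIN (piece T-5′, conditional on T-1′)

Crux item stmt-ResolutionOfSingularities-8899 `LocalWeightedDrop` (route `ResolutionOfSingularities/WeightedInvariant`), door
`WeightedConstruction` stmt-ResolutionOfSingularities-0571.  [OURS · L1 W4.3, chain w43, lead prover; piece T-5′ (`stub_monicDescentNoChain` of the line under
the registered stub `stub_monicDoublePointDescends`) of `N4PRIME-PLAN.md` §9, steps (s4b)–(s6).  MODEL: Cossart–Jannsen–Saito LNM 2270 Thm 13.7 /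
Claim 13.8 (k = k̄ of characteristic 2, J = ⟨y² + A₁y + A₀⟩).]

* `step_curve` — CURVE-STEP LAW for the straightened prepared labels `Â m` of `…TailPointStep`: `ε` is kept and `ζ` drops by `2`
  (`divOne_shear`, column transfer, `u₁ ∣ ψ₀`, `divOne_recentre`, `epsL_zetaL_eq_of_wellPrepared`, `zetaL_image_shiftOne`);
* `epsL_Ahat_le_one` — `ε(Â m) ≤ 1` (else the limit shear exhibits a graph curve at a point step, excluded by β-neutrality);
* `zetaL_Ahat_add_le` — `ζ(Â m) + m ≤ ζ(Â 0)`: a β-neutral chain cannot be infinite;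
* `monicDescentNoChain` — T-5′: conditional on T-1′ there is NO infinite Σ**-chain of well-prepared reduced positions (shift to the β-neutral tail by
  `exists_neutral_tail`, p491410).
-/

set_option linter.dupNamespace false -- mandated namespace of this single-conjunct summit

noncomputable section

namespace Summit.ResolutionOfSingularities.ResolutionOfSingularities.Theorems

namespace MonicDescent

open MvPowerSeries Literature.RingTheory.TwoVariableSeries

variable {k : Type} [Field k]

section Tail

variable [CharP k 2] [IsAlgClosed k]
  (hT1 : ∀ (k : Type) [Field k] [CharP k 2] [IsAlgClosed k] (A₀ A₁ : MvPowerSeries (Fin 2) k),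
    IsPosition A₀ A₁ → ∃ ψ : MvPowerSeries (Fin 2) k, IsPrepRecentring A₀ A₁ ψ)
  (A : ℕ → Label k)
  (hA : ∀ m, WellPrepared (A m).1 (A m).2 ∧ IsPosition (A m).1 (A m).2 ∧ ¬ IsDoublePlane (A m).1 (A m).2 ∧
    IsNeutralStep (A m) (A (m + 1)))
  (hex : ∀ m, ∃ n, m ≤ n ∧ IsPointStep A n)

include hT1 hA in
/-- CURVE-STEP LAW: at a `V(y,u₁)`-step, `ε(Â (m+1)) = ε(Â m)` and `ζ(Â (m+1)) + 2 = ζ(Â m)`. -/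
theorem step_curve {m : ℕ} (hm : ¬ IsPointStep A m) :
    epsL (newtonSet (Ahat A hex (m + 1)).1 (Ahat A hex (m + 1)).2) = epsL (newtonSet (Ahat A hex m).1 (Ahat A hex m).2) ∧
    zetaL (newtonSet (Ahat A hex (m + 1)).1 (Ahat A hex (m + 1)).2) + 2 = zetaL (newtonSet (Ahat A hex m).1 (Ahat A hex m).2) := by
  have hP1 : IsPermissibleOne (A m).1 (A m).2 := by unfold IsPointStep at hm; push Not at hm; exact hm
  have hsucc : A (m + 1) = divOneLabel (A m) := succ_eq_divOneLabel A hA hm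
  have hh : hser A hex (m + 1) = hser A hex m := hser_of_not_isPointStep A hex hm
  set h := hser A hex m with hhdef
  set S₀ := (Slab A hex m).1 with hS₀
  set S₁ := (Slab A hex m).2 with hS₁
  have hSP1 : IsPermissibleOne S₀ S₁ := isPermissibleOne_shear h hP1
  -- S (m+1) = divOneLabel (S m)
  have hS'₀ : (Slab A hex (m + 1)).1 = divOne 2 S₀ := by
    show shear (hser A hex (m + 1)) (A (m + 1)).1 = _
    rw [hh, hsucc]
    exact (divOne_shear 2 _ _ hP1.1).symm
  have hS'₁ : (Slab A hex (m + 1)).2 = divOne 1 S₁ := by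
    show shear (hser A hex (m + 1)) (A (m + 1)).2 = _
    rw [hh, hsucc]
    exact (divOne_shear 1 _ _ hP1.2).symm
  -- Â m = recentre ψ₀ (S m) is well prepared and has V(y,u₁) permissible
  set ψ₀ := prepPsi S₀ S₁ with hψ₀def
  obtain ⟨hψ₀0, -, hÂWP, -⟩ := prep_Slab hT1 A hA hex m
  obtain ⟨hÂWP', hÂpos, hÂne, hÂdef⟩ := Ahat_spec hT1 A hA hex m
  have hÂ₀ : (Ahat A hex m).1 = S₀ + S₁ * ψ₀ + ψ₀ ^ 2 := rfl
  have hÂ₁ : (Ahat A hex m).2 = S₁ := recentre_snd_eq _ _ _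
  have hback : recentre ψ₀ (Ahat A hex m).1 (Ahat A hex m).2 = (S₀, S₁) := by
    have h1 : (recentre ψ₀ (Ahat A hex m).1 (Ahat A hex m).2).1 = S₀ := by
      rw [hÂdef, recentre_recentre_eq, show ψ₀ + ψ₀ = 0 from by
        have h2 : (2 : MvPowerSeries (Fin 2) k) = 0 := two_eq_zero
        linear_combination ψ₀ * h2, recentre_zero]
    have h2' : (recentre ψ₀ (Ahat A hex m).1 (Ahat A hex m).2).2 = S₁ := by rw [recentre_snd_eq, hÂ₁]
    exact Prod.ext h1 h2'
  have hÂP1 : IsPermissibleOne (Ahat A hex m).1 (Ahat A hex m).2 := by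
    apply isPermissibleOne_of_wellPrepared_of_recentre (χ := ψ₀) hÂWP'
    rw [hback]; exact hSP1
  -- u₁ ∣ ψ₀
  have hdvd : X 0 ∣ ψ₀ := by
    refine X_dvd_recentring_of_isPermissibleOne hSP1 ?_
    rw [← hÂ₀, ← hÂ₁]; exact hÂP1
  obtain ⟨ψ₀', hψ₀'⟩ := hdvd
  -- T := divOneLabel (S m); X := divOneLabel (Â m) = recentre ψ₀' T; Y := Â (m+1) = recentre ψ₁ T
  set T₀ := divOne 2 S₀ with hT₀
  set T₁ := divOne 1 S₁ with hT₁
  have hX₀ : divOne 2 (Ahat A hex m).1 = T₀ + T₁ * ψ₀' + ψ₀' ^ 2 := by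
    rw [hÂ₀, hψ₀', divOne_recentre S₀ S₁ ψ₀' hSP1.1 hSP1.2]
  have hX₁ : divOne 1 (Ahat A hex m).2 = T₁ := by rw [hÂ₁]
  set ψ₁ := prepPsi (Slab A hex (m + 1)).1 (Slab A hex (m + 1)).2 with hψ₁def
  obtain ⟨-, -, hÂ'WP, -⟩ := prep_Slab hT1 A hA hex (m + 1)
  have hY₀ : (Ahat A hex (m + 1)).1 = T₀ + T₁ * ψ₁ + ψ₁ ^ 2 := by
    show (Slab A hex (m + 1)).1 + (Slab A hex (m + 1)).2 * ψ₁ + ψ₁ ^ 2 = _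
    rw [hS'₀, hS'₁]
  have hY₁ : (Ahat A hex (m + 1)).2 = T₁ := by
    show (Slab A hex (m + 1)).2 + 2 * ψ₁ = _
    rw [hS'₁, two_eq_zero, zero_mul, add_zero]
  have hYX : (Ahat A hex (m + 1)).1 =
      divOne 2 (Ahat A hex m).1 + divOne 1 (Ahat A hex m).2 * (ψ₀' + ψ₁) + (ψ₀' + ψ₁) ^ 2 := by
    rw [hY₀, hX₀, hX₁]
    have h2 : (2 : MvPowerSeries (Fin 2) k) = 0 := two_eq_zero
    linear_combination (-(T₁ * ψ₀') - ψ₀' * ψ₁ - ψ₀' ^ 2) * h2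
  -- X is WP with Newton set = shiftOne-image
  have hfst := two_le_fst_of_isPermissibleOne hÂP1
  have hNX : newtonSet (divOne 2 (Ahat A hex m).1) (divOne 1 (Ahat A hex m).2) = shiftOne '' newtonSet (Ahat A hex m).1 (Ahat A hex m).2 :=
    newtonSet_divOne _ _ hfst
  have hXWP : WellPrepared (divOne 2 (Ahat A hex m).1) (divOne 1 (Ahat A hex m).2) := wellPrepared_divOne _ _ hfst hÂWP'
  have hXne : (newtonSet (divOne 2 (Ahat A hex m).1) (divOne 1 (Ahat A hex m).2)).Nonempty := by
    rw [hNX]; exact hÂne.image _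
  obtain ⟨-, -, hYne, -⟩ := Ahat_spec hT1 A hA hex (m + 1)
  have hY₁' : (Ahat A hex (m + 1)).2 = divOne 1 (Ahat A hex m).2 := by rw [hY₁, hX₁]
  have hYWP' : WellPrepared (divOne 2 (Ahat A hex m).1 + divOne 1 (Ahat A hex m).2 * (ψ₀' + ψ₁) + (ψ₀' + ψ₁) ^ 2)
      (divOne 1 (Ahat A hex m).2) := by
    rw [← hYX, ← hY₁']; exact hÂ'WP
  have hYne' : (newtonSet (divOne 2 (Ahat A hex m).1 + divOne 1 (Ahat A hex m).2 * (ψ₀' + ψ₁) + (ψ₀' + ψ₁) ^ 2)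
      (divOne 1 (Ahat A hex m).2)).Nonempty := by
    rw [← hYX, ← hY₁']; exact hYne
  obtain ⟨hε, hζ⟩ := epsL_zetaL_eq_of_wellPrepared hXWP hYWP' hXne hYne'
  rw [← hYX] at hε hζ
  rw [hY₁', hε, hζ, hNX, epsL_image_shiftOne, zetaL_image_shiftOne hÂne]
  obtain ⟨P, hP, hP1, hP0⟩ := exists_eq_zetaL hÂne
  have := hfst P hP
  exact ⟨rfl, by omega⟩

include hT1 hA in
/-- `ε(Â m) ≤ 1` at a point step: otherwise `V(y,u₂)` would be permissible for `Â m = recentre ψ₀ ((A m)(u₁, u₂ + u₁·hser m))`, i.e. `A m` would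
have a graph curve — excluded at a point step of a β-neutral chain. -/
theorem epsL_Ahat_le_one_of_isPointStep {m : ℕ} (hm : IsPointStep A m) :
    epsL (newtonSet (Ahat A hex m).1 (Ahat A hex m).2) ≤ 1 := by
  by_contra hlt
  push Not at hlt
  obtain ⟨-, -, hngc, -⟩ := pointStep_cases A hA hm
  apply hngc
  obtain ⟨hψ₀0, -, -, -⟩ := prep_Slab hT1 A hA hex m
  refine ⟨hser A hex m, prepPsi (Slab A hex m).1 (Slab A hex m).2, hser_noY A hex m, hψ₀0, ?_⟩
  change IsPermissibleTwo (Ahat A hex m).1 (Ahat A hex m).2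
  refine ⟨fun d hd => ?_, fun d hd => ?_⟩
  · have := epsL_le (N := newtonSet (Ahat A hex m).1 (Ahat A hex m).2) (Or.inl hd)
    omega
  · have := epsL_le (N := newtonSet (Ahat A hex m).1 (Ahat A hex m).2) (P := 2 • d) (Or.inr ⟨d, rfl, hd⟩)
    simp only [Finsupp.smul_apply, smul_eq_mul] at this
    omega

include hT1 hA in
/-- `ε` is constant along the straightened chain. -/
theorem epsL_Ahat_succ (m : ℕ) :
    epsL (newtonSet (Ahat A hex (m + 1)).1 (Ahat A hex (m + 1)).2) = epsL (newtonSet (Ahat A hex m).1 (Ahat A hex m).2) := by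
  by_cases hm : IsPointStep A m
  · exact (step_point hT1 A hA hex hm).1
  · exact (step_curve hT1 A hA hex hm).1

include hT1 hA in
/-- `ε(Â m) ≤ 1` for every `m`. -/
theorem epsL_Ahat_le_one (m : ℕ) : epsL (newtonSet (Ahat A hex m).1 (Ahat A hex m).2) ≤ 1 := by
  obtain ⟨n, hmn, hn⟩ := hex m
  have hconst : ∀ j, epsL (newtonSet (Ahat A hex (m + j)).1 (Ahat A hex (m + j)).2) =
      epsL (newtonSet (Ahat A hex m).1 (Ahat A hex m).2) := by
    intro j
    induction j with
    | zero => rfl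
    | succ j ih => rw [show m + (j + 1) = m + j + 1 from by omega, epsL_Ahat_succ hT1 A hA hex, ih]
  have := epsL_Ahat_le_one_of_isPointStep hT1 A hA hex hn
  obtain ⟨j, rfl⟩ : ∃ j, n = m + j := ⟨n - m, by omega⟩
  rw [hconst j] at this
  exact this

include hT1 hA in
/-- `ζ` DROPS at every step of the straightened chain. -/
theorem zetaL_Ahat_succ_lt (m : ℕ) :
    zetaL (newtonSet (Ahat A hex (m + 1)).1 (Ahat A hex (m + 1)).2) + 1 ≤ zetaL (newtonSet (Ahat A hex m).1 (Ahat A hex m).2) := by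
  by_cases hm : IsPointStep A m
  · obtain ⟨-, hζ⟩ := step_point hT1 A hA hex hm
    have hε := epsL_Ahat_le_one hT1 A hA hex m
    obtain ⟨-, hpos, hne, -⟩ := Ahat_spec hT1 A hA hex m
    obtain ⟨P, hP, hP1, hP0⟩ := exists_eq_zetaL hne
    have h3 := three_le_sum_of_isPosition hpos P hP
    rw [hζ]
    omega
  · have := (step_curve hT1 A hA hex hm).2
    omega

include hT1 hA in
/-- THE POTENTIAL: `ζ(Â m) + m ≤ ζ(Â 0)` for all `m` — so a β-neutral chain cannot be infinite. -/
theorem zetaL_Ahat_add_le (m : ℕ) :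
    zetaL (newtonSet (Ahat A hex m).1 (Ahat A hex m).2) + m ≤ zetaL (newtonSet (Ahat A hex 0).1 (Ahat A hex 0).2) := by
  induction m with
  | zero => simp
  | succ m ih => have := zetaL_Ahat_succ_lt hT1 A hA hex m; omega

end Tail

/-- PIECE T-5′ (conditional on T-1′): there is NO infinite Σ**-chain of well-prepared reduced positions.  (CJS LNM 2270 Thm 13.7 for
`J = ⟨y² + A₁y + A₀⟩` over `k̄[[u₁,u₂]]`, char 2, in label form: `2β` stabilises (`exists_neutral_tail`), then along the tail straightened by the limit shear
`ζ` drops at every step (`zetaL_Ahat_add_le`).) -/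
theorem monicDescentNoChain
    (hT1 : ∀ (k : Type) [Field k] [CharP k 2] [IsAlgClosed k] (A₀ A₁ : MvPowerSeries (Fin 2) k),
      IsPosition A₀ A₁ → ∃ ψ : MvPowerSeries (Fin 2) k, IsPrepRecentring A₀ A₁ ψ) :
    ∀ (k : Type) [Field k] [CharP k 2] [IsAlgClosed k],
      ¬ ∃ A : ℕ → Label k, ∀ m, WellPrepared (A m).1 (A m).2 ∧ IsPosition (A m).1 (A m).2 ∧
        ¬ IsDoublePlane (A m).1 (A m).2 ∧ A (m + 1) ∈ succLabels (A m) := by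
  intro k _ _ _ ⟨A, hA⟩
  obtain ⟨M, hM⟩ := exists_neutral_tail hT1 A hA
  set B : ℕ → Label k := fun m => A (M + m) with hB
  have hB' : ∀ m, WellPrepared (B m).1 (B m).2 ∧ IsPosition (B m).1 (B m).2 ∧ ¬ IsDoublePlane (B m).1 (B m).2 ∧
      IsNeutralStep (B m) (B (m + 1)) := by
    intro m
    refine ⟨(hA (M + m)).1, (hA (M + m)).2.1, (hA (M + m)).2.2.1, ?_⟩
    have := (hM (M + m) (by omega)).2
    show IsNeutralStep (A (M + m)) (A (M + (m + 1)))
    rwa [show M + (m + 1) = M + m + 1 from by omega]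
  have := zetaL_Ahat_add_le hT1 B hB' (exists_isPointStep_ge B hB')
    (zetaL (newtonSet (Ahat B (exists_isPointStep_ge B hB') 0).1 (Ahat B (exists_isPointStep_ge B hB') 0).2) + 1)
  omega

end MonicDescent

end Summit.ResolutionOfSingularities.ResolutionOfSingularities.Theorems

end
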